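import Literature.AnabelianGeometry.EtaleTheta.TemperedFrobenioidCoprimePull
import Literature.AnabelianGeometry.EtaleTheta.TemperedFrobenioidOfDiagonalBase
import HarnessLib

/-!
# [EtTh] Def. 3.6 (ii) / Def. 4.1 (i): the coprimality-pull-back law at HIGHER RANK — transfer from the perfection `Φ₀^pf`
# to abc-iut-w5-d179's diagonal-base tempered Frobenioids (`TemperedFrobenioid.ofDiagonalBase`)

S. Mochizuki, *The étale theta function …*, Publ. RIMS **45** (2009) [MochizukiEtTh2009], §3 Def. 3.3 (iii) p.73, Def. 3.6 (ii)
p.77, §4 Def. 4.1 (i) p.86 («`Div(s′)`, `Div(s″)` have disjoint supports [cf. [FrdI], Proposition 4.1, (iii)]»), proof of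
Prop. 4.2 (iii) pp.89–90 [cite: MochizukiEtTh2009, Def 4.1 (i) p.86]; [FrdI] = [MochizukiFrdI2008] Def. 2.4 (i) p.47
(`M^pf → M^rlf` injective).

abc-iut cell, layer L2; seat abc-iut-L2-t3 (gen 6), sequel of `TemperedFrobenioidCoprimePull.lean` (predicate of record
`TemperedFrobenioid.CoprimePullLaw` = the binder `hDSpull` of GAP G-w5d063-1, ✓ at rank one, ✗ in general by
`ShearToy.not_coprimePull`).  PROOF-ONLY (0 defs).  At rank `> 1` the only engine in the tree is abc-iut-w5-d179's
`TemperedFrobenioid.ofDiagonalBase hpf P hD hD' hFSM R S` (`Φ(A) := im(Φ₀(F A)^pf → Φ₀(F A)^rlf)`), and there the law does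
NOT follow from the engine's own axioms (`hΦinj`, `hΦrefl`: e.g. `ℤ²_{≥0} → ℤ³_{≥0}`, `e₁ ↦ (1,1,0)`, `e₂ ↦ (0,1,1)` is injective and
reflects divisibility, yet maps the coprime `e₁, e₂` to elements sharing `(0,1,0)`).  What it DOES follow from is the same law
ONE LEVEL DOWN, on the perfections of the `Φ₀`-values along `F`:
* **`coprimePullLaw_ofDiagonalBase_of_perfection`** — if for every arrow `f : B ⟶ A` of `D` the pull-back
  `Φ₀(F f)^pf : Φ₀(F A)^pf → Φ₀(F B)^pf` carries coprime pairs to coprime pairs, then `CoprimePullLaw (ofDiagonalBase …)`;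
  the transfer is along the isomorphism `Φ₀(F A)^pf ≅ Φ(A)` (`M^pf → M^rlf` injective, [FrdI] Def. 2.4 (i)) and the naturality
  `Φ₀(F f)^rlf ∘ ι = ι ∘ Φ₀(F f)^pf` (`rlfMapWeak_comp_toRealification`);
* the same transfer for abc-iut-w6-d048's `ofRankOneBase` is not needed (rank one: `coprimePullLaw_ofRankOneBase`).
So at the datum-specific instances (abc-iut-w5-d179's ℤ-tower `ZTowerTempered`, the Kummer–Tate diagonal base in flight) the
remaining input is the GEOMETRIC one — equivariant effective divisors with disjoint supports stay disjoint under pull-back of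
functions and under the level change (pointwise minima) — stated on `Φ₀^pf` only, with no realification bookkeeping left.
HONEST FRAMING: an implication between OUR typed predicates; nothing asserted about tempered Frobenioids of curves; nothing
here bears on the disputed [IUTchIII] Cor. 3.12; no side taken; typed ≠ proved.
-/

namespace Literature.AnabelianGeometry.EtaleTheta

open CategoryTheory Opposite Function Literature.AlgebraicGeometry.Frobenioids

universe u₀ v₀ u v

namespace TemperedFrobenioid

variable {D₀ : Type u₀} [Category.{v₀} D₀] {dm : DivisorMonoids.{u₀, v₀, 0} D₀}
  (hpf : ∀ Y : D₀ᵒᵖ, IsPerfFactorialCof (dm.Φ₀.obj Y)) {D : Type u} [Category.{v} D] (P : DiagonalBase dm D)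
  (hD : IsConnected D) (hD' : IsTotallyEpimorphic D) (hFSM : IsOfFSMType D) (R S : (Dᵒᵖ ⥤ CommMonCat.{0}) → Prop)

/-- Every element of `Φ(A)` is the class of an element of the perfection `Φ₀(F A)^pf`. [cite: MochizukiFrdI2008, Def. 2.4(i) p.47] -/
theorem exists_eq_toRealification (A : Dᵒᵖ) (a : (ofDiagonalBase hpf P hD hD' hFSM R S).Φ.carrier A) :
    ∃ α : Perfection (dm.Φ₀.obj (op (P.F.obj A.unop))), (hpf (op (P.F.obj A.unop))).weak.toRealification α = a.1 :=
  a.2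

/-- Divisibility in `Φ(A)` is divisibility in `Φ₀(F A)^pf` (`M^pf → M^rlf` injective). [cite: MochizukiFrdI2008, Def. 2.4(i) p.47] -/
theorem dvd_of_toRealification_dvd (A : Dᵒᵖ) (α β : Perfection (dm.Φ₀.obj (op (P.F.obj A.unop))))
    (a b : (ofDiagonalBase hpf P hD hD' hFSM R S).Φ.carrier A)
    (ha : (hpf (op (P.F.obj A.unop))).weak.toRealification α = a.1)
    (hb : (hpf (op (P.F.obj A.unop))).weak.toRealification β = b.1) (h : a ∣ b) : α ∣ β := by
  obtain ⟨c, hc⟩ := h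
  obtain ⟨γ, hγ⟩ := exists_eq_toRealification hpf P hD hD' hFSM R S A c
  refine ⟨γ, PfImageWeak.toRealification_injective (hpf (op (P.F.obj A.unop))).weak ?_⟩
  rw [map_mul, ha, hγ, hb]
  exact congrArg Subtype.val hc

/-- Conversely, divisibility in `Φ₀(F A)^pf` gives divisibility in `Φ(A)`. [cite: MochizukiFrdI2008, Def. 2.4(i) p.47] -/
theorem toRealification_dvd_of_dvd (A : Dᵒᵖ) (α β : Perfection (dm.Φ₀.obj (op (P.F.obj A.unop))))
    (a b : (ofDiagonalBase hpf P hD hD' hFSM R S).Φ.carrier A)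
    (ha : (hpf (op (P.F.obj A.unop))).weak.toRealification α = a.1)
    (hb : (hpf (op (P.F.obj A.unop))).weak.toRealification β = b.1) (h : α ∣ β) : a ∣ b := by
  obtain ⟨γ, rfl⟩ := h
  refine ⟨⟨(hpf (op (P.F.obj A.unop))).weak.toRealification γ, γ, rfl⟩, Subtype.ext ?_⟩
  have hm : (hpf (op (P.F.obj A.unop))).weak.toRealification (α * γ) =
      (hpf (op (P.F.obj A.unop))).weak.toRealification α * (hpf (op (P.F.obj A.unop))).weak.toRealification γ :=
    map_mul _ _ _
  rw [hb, ha] at hm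
  exact hm

/-- The pull-back of `Φ` along `f : B ⟶ A` is `Φ₀(F f)^pf` on representatives (naturality of `M^pf → M^rlf`).
[cite: MochizukiEtTh2009, Def 3.6 p.76] -/
theorem coe_pull_ofDiagonalBase {A B : D} (f : B ⟶ A) (α : Perfection (dm.Φ₀.obj (op (P.F.obj A))))
    (a : (ofDiagonalBase hpf P hD hD' hFSM R S).Φ.carrier (op A))
    (ha : (hpf (op (P.F.obj A))).weak.toRealification α = a.1) :
    (hpf (op (P.F.obj B))).weak.toRealification (Literature.AlgebraicGeometry.Frobenioids.Perfection.map (dm.Φ₀.map (P.F.map f).op).hom α) =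
      (pull (ofDiagonalBase hpf P hD hD' hFSM R S).divisorMonoid f a).1 := by
  have h := DFunLike.congr_fun (rlfMapWeak_comp_toRealification dm.Φ₀ hpf (P.F.map f).op) α
  simp only [MonoidHom.comp_apply] at h
  rw [ha] at h
  exact h.symm

/-- **The coprimality-pull-back law at HIGHER RANK, transferred from the perfections**: if along every arrow `f : B ⟶ A` of `D`
the pull-back `Φ₀(F f)^pf` carries pairs without common non-trivial divisor to such pairs, then the diagonal-base tempered
Frobenioid satisfies `CoprimePullLaw` (= the binder `hDSpull` of [EtTh] Prop. 4.2 (iii)'s law-level closers).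
[cite: MochizukiEtTh2009, Def 4.1 (i) p.86] -/
theorem coprimePullLaw_ofDiagonalBase_of_perfection
    (H : ∀ {A B : D} (f : B ⟶ A) (α β : Perfection (dm.Φ₀.obj (op (P.F.obj A)))),
      (∀ ξ : Perfection (dm.Φ₀.obj (op (P.F.obj A))), ξ ∣ α → ξ ∣ β → ξ = 1) →
        ∀ η : Perfection (dm.Φ₀.obj (op (P.F.obj B))),
          η ∣ Literature.AlgebraicGeometry.Frobenioids.Perfection.map (dm.Φ₀.map (P.F.map f).op).hom α →
            η ∣ Literature.AlgebraicGeometry.Frobenioids.Perfection.map (dm.Φ₀.map (P.F.map f).op).hom β → η = 1) :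
    (ofDiagonalBase hpf P hD hD' hFSM R S).CoprimePullLaw := by
  intro A B f a b hab y hya hyb
  obtain ⟨α, hα⟩ := exists_eq_toRealification hpf P hD hD' hFSM R S (op A) a
  obtain ⟨β, hβ⟩ := exists_eq_toRealification hpf P hD hD' hFSM R S (op A) b
  obtain ⟨η, hη⟩ := exists_eq_toRealification hpf P hD hD' hFSM R S (op B) y
  -- `α, β` are coprime in the perfection
  have hαβ : ∀ ξ : Perfection (dm.Φ₀.obj (op (P.F.obj A))), ξ ∣ α → ξ ∣ β → ξ = 1 := by
    intro ξ hξα hξβ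
    have hx : (⟨(hpf (op (P.F.obj A))).weak.toRealification ξ, ξ, rfl⟩ :
        (ofDiagonalBase hpf P hD hD' hFSM R S).Φ.carrier (op A)) = 1 :=
      hab _ (toRealification_dvd_of_dvd hpf P hD hD' hFSM R S (op A) ξ α _ a rfl hα hξα)
        (toRealification_dvd_of_dvd hpf P hD hD' hFSM R S (op A) ξ β _ b rfl hβ hξβ)
    refine PfImageWeak.toRealification_injective (hpf (op (P.F.obj A))).weak ?_
    rw [map_one]
    exact congrArg Subtype.val hx
  -- `η` divides the pull-backs of `α`, `β` in the perfection, hence is trivial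
  have hηα : η ∣ Literature.AlgebraicGeometry.Frobenioids.Perfection.map (dm.Φ₀.map (P.F.map f).op).hom α :=
    dvd_of_toRealification_dvd hpf P hD hD' hFSM R S (op B) η _ y _ hη
      (coe_pull_ofDiagonalBase hpf P hD hD' hFSM R S f α a hα) hya
  have hηβ : η ∣ Literature.AlgebraicGeometry.Frobenioids.Perfection.map (dm.Φ₀.map (P.F.map f).op).hom β :=
    dvd_of_toRealification_dvd hpf P hD hD' hFSM R S (op B) η _ y _ hη
      (coe_pull_ofDiagonalBase hpf P hD hD' hFSM R S f β b hβ) hyb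
  have hη1 : η = 1 := H f α β hαβ η hηα hηβ
  apply Subtype.ext
  change y.1 = 1
  rw [← hη, hη1, map_one]
  rfl

end TemperedFrobenioid

end Literature.AnabelianGeometry.EtaleTheta
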